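import Summits.QuantumFields.QCD.Theses.HeatSlicedQuarks
import Literature.MathematicalPhysics.QuantumFieldTheory.QCDTransferMatrix
import Literature.Analysis.OperatorTheory.HermitianKernelSandwichedTrace

/-!
# Stub `stub_sandwichedTrace` of line `pin-the-infimum` (crux `RobustYangMillsHandover`, item 8892)

The abstract complex SANDWICHED-INSERTION TRACE FORMULA (M1(b) of the Lüscher dictionary infrastructure,
the engine behind trace formulas WITH INSERTIONS): for a bounded Hermitian kernel `K` on a finite measure
space, its `L²` integral operator `A` (compact self-adjoint), a countable Hilbert basis of eigenvectors
`A bᵢ = λᵢ bᵢ` with real eigenvalues, and ANY bounded operator `B` whose sandwich `A B A` is given a.e. by a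
bounded strongly measurable kernel `k_B`,
`Σᵢ λᵢ^{M+4} ⟨bᵢ, B bᵢ⟩ = ∫ k_B(V 0, V 1) K(V 1, V 2) ⋯ K(V (M+2), V 0) dμ^{⊗(M+3)}(V)`  ("`Tr(B A^{M+4})`" as a
periodic path integral of the kernels `k_B, K, …, K`, without trace-class theory).  It is the `𝕜 = ℂ` instance
of `Literature.Analysis.OperatorTheory.hasSum_pow_inner_sandwich_rclike`
(`Literature/Analysis/OperatorTheory/HermitianKernelSandwichedTrace.lean`: peeling of the heterogeneous first
bond, the one-variable pointwise spectral expansion `∫ k_B(x, y) K^{(M+2)}(y, x) dμ(y) =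
Σᵢ λᵢ^{M+1} (κ_B bᵢ)(x) conj((κ bᵢ)(x))`, dominated convergence with a Bessel dominant, and
`⟨bᵢ, A B A bᵢ⟩ = λᵢ² ⟨bᵢ, B bᵢ⟩`).  Intended instances: quark observables as fibrewise Fock operators `B`
sandwiched by the slice transfer operator of the time-periodic QCD torus functional, and the physical-subspace
insertion `B = Θ P̂₀`.
-/

open MeasureTheory Filter Function Matrix
open Literature.MathematicalPhysics.QuantumFieldTheory Literature.MathematicalPhysics.QuantumLattice
open Literature.Probability.LatticeModels
open scoped InnerProductSpace

namespace Summit.QuantumFields.QCD.Cruxes.RobustYangMillsHandover.PinTheInfimum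

/-- **T3 (M1(b)): sandwiched-insertion trace formula `Tr(B A^{M+4}) = ∫ k_{ABA}(V0,V1) K(V1,V2)⋯K(V_{M+2},V0)`.**
For a bounded, strongly measurable, Hermitian kernel `K : X → X → ℂ` on a finite measure space, any bounded
operator `A` on `L²(X, μ; ℂ)` given a.e. by the kernel, any countable Hilbert basis `b` of eigenvectors of `A`
with real eigenvalues `lam`, any bounded operator `B` such that `A ∘ B ∘ A` is given a.e. by a bounded strongly
measurable kernel `kB`, and every `M`,
`Σᵢ λᵢ^{M+4} ⟪bᵢ, B bᵢ⟫ = ∫ kB(V 0, V 1) ∏_{t : Fin (M+2)} K(V (t+1), V (t+2)) dμ^{⊗(M+3)}(V)`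
(`Literature.Analysis.OperatorTheory.hasSum_pow_inner_sandwich`; B. Simon, *Trace Ideals* (2005), Ch. 3;
Reed–Simon I §VI.6).  The statement is the registered stub signature verbatim. -/
theorem stub_sandwichedTrace :
    ∀ {X : Type*} [MeasurableSpace X] (μ : Measure X) [IsFiniteMeasure μ] (K : X → X → ℂ) (C : ℝ),
      StronglyMeasurable (uncurry K) → (∀ x y, ‖K x y‖ ≤ C) → (∀ x y, K x y = (starRingEnd ℂ) (K y x)) →
      ∀ (A : Lp ℂ 2 μ →L[ℂ] Lp ℂ 2 μ),
        (∀ φ : Lp ℂ 2 μ, (A φ : X → ℂ) =ᵐ[μ] fun x => ∫ y, K x y * φ y ∂μ) →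
        ∀ {ι : Type*} [Countable ι] (b : HilbertBasis ι ℂ (Lp ℂ 2 μ)) (lam : ι → ℝ),
          (∀ i, A (b i) = (lam i : ℂ) • (b i : Lp ℂ 2 μ)) →
          ∀ (B : Lp ℂ 2 μ →L[ℂ] Lp ℂ 2 μ) (kB : X → X → ℂ) (CB : ℝ),
            StronglyMeasurable (uncurry kB) → (∀ x y, ‖kB x y‖ ≤ CB) →
            (∀ φ : Lp ℂ 2 μ, ((A.comp (B.comp A)) φ : X → ℂ) =ᵐ[μ] fun x => ∫ y, kB x y * φ y ∂μ) →
            ∀ M : ℕ, HasSum (fun i => (lam i : ℂ) ^ (M + 4) * ⟪(b i : Lp ℂ 2 μ), B (b i)⟫_ℂ)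
              (∫ V : Fin (M + 3) → X, kB (V 0) (V 1) * ∏ t : Fin (M + 2), K (V t.succ) (V (t.succ + 1))
                ∂(Measure.pi fun _ => μ)) := by
  intro X _ μ _ K C hK hC hherm A hA ι _ b lam hb B kB CB hkB hCB hABA M
  exact Literature.Analysis.OperatorTheory.hasSum_pow_inner_sandwich μ K C hK hC hherm A hA b lam hb B kB CB
    hkB hCB hABA M

end Summit.QuantumFields.QCD.Cruxes.RobustYangMillsHandover.PinTheInfimum
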